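import Literature.Analysis.FluidPDE.TaoCascadeZeroScaleCritical
import Literature.Analysis.FluidPDE.TaoCascadeZeroScaleRotorPhase
import HarnessLib

/-!
# Tao's cascade ODE, §6.7: the rotor phase `[t_c, τ₁]` and Prop. 6.16 (exit dichotomy)

T. Tao, *Finite time blowup for an averaged three-dimensional Navier–Stokes equation*,
J. Amer. Math. Soc. 29 (2016), 601–674 = arXiv:1402.0290v3, §6.7, from (6.160) ("we now move to
the future of `t_c`, and specifically in the interval `[t_c, τ₁]` where
`τ₁ := min(t_c + K^{-1/2}, T₂)`") to Prop. 6.16 and the displays (6.162)–(6.167), (6.180)–(6.181)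
(display numbers of arXiv v3; authoritative locators are the proposition numbers).

Continuation of `TaoCascadeZeroScaleCritical.lean` (`ZeroScale.Setting`, the time `t_c` with
`t_c ≥ 1/2`, `t_c < 2`, `t_c < T`, `c₀(t_c) = K⁻¹⁰ε²`). In the same packaging and with every
constant numeric, this file proves:

* `ZeroScale.τone` = `τ₁ := min(t_c + K^{-1/2}, T)` and its range (`t_c ≤ τ₁ ≤ T`,
  `τ₁ ≤ t_c + K^{-1/2} < 3`);
* (6.162)/(6.180) `0.48 ε ≤ b₀ ≤ 4 ε` on `[t_c, τ₁]` (`Setting.b_zero_rotor`);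
* (6.163)–(6.165) `c₀(t) ≥ ½K⁻¹⁰ε² exp(0.48 K¹⁰ (t - t_c))` on `[t_c, τ₁]`, hence `c₀ > 0`,
  `c₀ ≥ ½K⁻¹⁰ε²`, and `c₀ ≥ K¹⁰⁰ ε²` on `I = [t_c + K⁻⁹, τ₁]` (`c_zero_rotor_lower`,
  `c_zero_rotor_pos`, `c_zero_large`; the numerical fact `2K¹¹⁰ ≤ e^{0.48K}` for `K ≥ 10⁶`);
* (6.166)–(6.167) `c₀(t) ≤ 2K⁻¹⁰ε² exp(4K¹⁰(t - t_c)) ≤ 2K⁻¹⁰ε² exp(4 K¹⁰ K^{-1/2})`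
  (`c_zero_rotor_upper`) and (6.164)/(6.166)/(6.181) `0.4K¹⁰c₀ ≤ ∂ₜc₀ ≤ 5K¹⁰c₀`
  (`dc_zero_rotor`);
* `∫₀ᵗ a₁² < K^{-1/4}` for `t ≤ τ₁` (the display after (6.160)) and **Prop. 6.16 (exit
  dichotomy)**: `Ẽ₋₁(τ₁) = K⁻¹⁰(1+ε₀)^{2/10}` or `τ₁ = t_c + K^{-1/2}`
  (`Setting.integral_a_one_sq_lt`, `Setting.exit_dichotomy`).

The growth/decay steps are instances of the landed interval lemmas `zero_b_lower_on`,
`zero_c_lower_on`, `zero_c_upper_on`, `zero_c_deriv_bounds` of `TaoCascadeZeroScaleRotorPhase.lean`.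

## References

* T. Tao, J. Amer. Math. Soc. 29 (2016), 601–674 = arXiv:1402.0290v3, §6.7 (6.160)–(6.167),
  Prop. 6.16, (6.180)–(6.181). [`Tao2016AveragedNS`]
-/

noncomputable section

open Set MeasureTheory intervalIntegral Filter Topology

namespace Literature.Analysis.FluidPDE

namespace TaoCascade

namespace ZeroScale

section Transition

variable {ε₀ K ε C₁ C₂ C₃ C₄ C₅ : ℝ} {n₀ N : ℤ} {τ : ℤ → ℝ} {Y : Fin 4 → ℤ → ℝ → ℝ}
  {F : ℤ → ℝ → ℝ} {T : ℝ}

/-! ## The rotor phase `[t_c, τ₁]`, `τ₁ := min(t_c + K^{-1/2}, T)` -/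

/-- **The time `τ₁ := min(t_c + K^{-1/2}, T₂)`** of §6.7 ((6.160)).
[cite: Tao2016AveragedNS, §6.7 (6.160)] -/
def τone (K ε : ℝ) (Y : Fin 4 → ℤ → ℝ → ℝ) (T : ℝ) : ℝ :=
  min (tc K ε Y T + K ^ (-(1 : ℝ) / 2)) T

/-- `K^{-1/2} ≤ 10⁻³` in the regime. [folklore] -/
theorem Setting.K_rpow_neg_half_le (hs : Setting ε₀ K ε C₁ C₂ C₃ C₄ C₅ n₀ N τ Y F T) :
    K ^ (-(1 : ℝ) / 2) ≤ 1 / 10 ^ 3 := by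
  have hK := hs.K_pos
  have h6 := hs.K_large
  rw [show -(1 : ℝ) / 2 = -((1 : ℝ) / 2) by ring, Real.rpow_neg hK.le, ← Real.sqrt_eq_rpow]
  rw [show (1 : ℝ) / 10 ^ 3 = (10 ^ 3)⁻¹ by norm_num]
  apply inv_anti₀ (by norm_num)
  rw [show (10 : ℝ) ^ 3 = Real.sqrt ((10 ^ 3) ^ 2) by rw [Real.sqrt_sq (by norm_num)]]
  exact Real.sqrt_le_sqrt (by nlinarith)

/-- `0 < K^{-1/2}`. [folklore] -/
theorem Setting.K_rpow_neg_half_pos (hs : Setting ε₀ K ε C₁ C₂ C₃ C₄ C₅ n₀ N τ Y F T) :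
    0 < K ^ (-(1 : ℝ) / 2) := Real.rpow_pos_of_pos hs.K_pos _

/-- `t_c ≤ τ₁ ≤ T`, `τ₁ ≤ t_c + K^{-1/2} < 3`. [cite: Tao2016AveragedNS, §6.7 (6.160)] -/
theorem Setting.τone_bounds (hs : Setting ε₀ K ε C₁ C₂ C₃ C₄ C₅ n₀ N τ Y F T)
    (hex : ExitTrichotomy ε₀ K Y F T) :
    tc K ε Y T ≤ τone K ε Y T ∧ τone K ε Y T ≤ T ∧
      τone K ε Y T ≤ tc K ε Y T + K ^ (-(1 : ℝ) / 2) ∧ τone K ε Y T < 3 := by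
  have h1 := hs.tc_lt_T hex
  have h2 := hs.tc_lt_two
  have h3 := hs.K_rpow_neg_half_le
  have h4 := hs.K_rpow_neg_half_pos
  unfold τone
  refine ⟨le_min (by linarith) h1.le, min_le_right _ _, min_le_left _ _, ?_⟩
  calc min (tc K ε Y T + K ^ (-(1 : ℝ) / 2)) T ≤ tc K ε Y T + K ^ (-(1 : ℝ) / 2) := min_le_left _ _
    _ < 3 := by linarith

/-- Times of the rotor phase are times of `[0, T]` and are `≤ 3`. [cite: Tao2016AveragedNS, §6.7] -/
theorem Setting.mem_rotor (hs : Setting ε₀ K ε C₁ C₂ C₃ C₄ C₅ n₀ N τ Y F T)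
    (hex : ExitTrichotomy ε₀ K Y F T) {t : ℝ} (ht : t ∈ Icc (tc K ε Y T) (τone K ε Y T)) :
    t ∈ Icc 0 T ∧ t ≤ 3 ∧ t - tc K ε Y T ≤ K ^ (-(1 : ℝ) / 2) := by
  obtain ⟨_, h2, h3, h4⟩ := hs.τone_bounds hex
  have htc := hs.tc_mem
  exact ⟨⟨htc.1.trans ht.1, ht.2.trans h2⟩, by linarith [ht.2], by linarith [ht.2]⟩

/-- `K⁻⁷ ≤ 10⁻⁵` in the regime. [folklore] -/
theorem Setting.inv_K7_le (hs : Setting ε₀ K ε C₁ C₂ C₃ C₄ C₅ n₀ N τ Y F T) :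
    (K ^ 7)⁻¹ ≤ 1 / 10 ^ 5 := by
  have := hs.inv_pow_succ_le 6
  have h6 : (K ^ 6)⁻¹ ≤ 1 := by
    have := hs.inv_pow_anti (n := 0) (m := 6) (by norm_num); simpa using this
  linarith

/-- On `[0, min(3, T)]`: `|c₀(t)| ≤ 10⁻⁴ ε² e^{9K¹⁰}` (from (6.148)).
[cite: Tao2016AveragedNS, §6.7 (6.148)] -/
theorem Setting.abs_c_zero_le_three (hs : Setting ε₀ K ε C₁ C₂ C₃ C₄ C₅ n₀ N τ Y F T) {t : ℝ}
    (ht : t ∈ Icc 0 T) (ht3 : t ≤ 3) :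
    |Y 2 0 t| ≤ 1 / 10 ^ 4 * ε ^ 2 * Real.exp (9 * K ^ 10) := by
  have h := hs.abs_c_zero_le ht
  refine h.trans ?_
  have hK := hs.K_pos
  have hε := hs.ε_pos
  gcongr
  have hK7 : (K ^ 7)⁻¹ ≤ 1 / 10 ^ 5 := hs.inv_K7_le
  have hK70 : 0 ≤ (K ^ 7)⁻¹ := by positivity
  have ht0 := ht.1
  have : t * (1 / 10 ^ 5 + t + (K ^ 7)⁻¹) ≤ 3 * (1 / 10 ^ 5 + 3 + 1 / 10 ^ 5) := by
    apply mul_le_mul ht3 (by linarith) (by positivity) (by norm_num)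
  have hK10 := pow_nonneg hK.le 10
  nlinarith

/-- **(6.162): `b₀ ≥ 0.48 ε` on the rotor phase** (and `b₀ ≤ 4ε`, the source's (6.180)
`|b₀| ≤ 10⁴ε`): `b₀(t_c) ≥ 0.49ε` by (6.157), and on `[t_c, τ₁]`,
`∂ₜb₀ ≥ -ε⁻¹K¹⁰c₀² - O((1+ε₀)^{-n₀/2}) ≥ -O(ε³ exp(O(K¹⁰)))` by (6.148).
[cite: Tao2016AveragedNS, §6.7 (6.162), (6.180)] -/
theorem Setting.b_zero_rotor (hs : Setting ε₀ K ε C₁ C₂ C₃ C₄ C₅ n₀ N τ Y F T)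
    (hex : ExitTrichotomy ε₀ K Y F T) {t : ℝ} (ht : t ∈ Icc (tc K ε Y T) (τone K ε Y T)) :
    48 / 100 * ε ≤ Y 1 0 t ∧ Y 1 0 t ≤ 4 * ε := by
  obtain ⟨htT, ht3, htK⟩ := hs.mem_rotor hex ht
  have hK := hs.K_pos
  have hε := hs.ε_pos
  have htc := hs.tc_mem
  have hhalf := hs.half_le_tc hex
  obtain ⟨hτ1, hτ2, hτ3, hτ4⟩ := hs.τone_bounds hex
  constructor
  · -- lower bound
    set C : ℝ := 1 / 10 ^ 4 * ε ^ 2 * Real.exp (9 * K ^ 10) with hC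
    have hreg : ∀ u ∈ Icc (tc K ε Y T) (τone K ε Y T), F 0 u ≤ 1 := fun u hu =>
      hs.F_zero_le_one (hs.mem_rotor hex hu).1
    have hA : ∀ u ∈ Icc (tc K ε Y T) (τone K ε Y T), (0:ℝ) ≤ Y 0 0 u ^ 2 := fun u _ => sq_nonneg _
    have hc : ∀ u ∈ Icc (tc K ε Y T) (τone K ε Y T), |Y 2 0 u| ≤ C := fun u hu =>
      hs.abs_c_zero_le_three (hs.mem_rotor hex hu).1 (hs.mem_rotor hex hu).2.1
    have h := hs.hyp.zero_b_lower_on hε.le hs.C₁_nn hs.ε₀_pos (hs.τ₀_le.trans htc.1) hreg hA hc ht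
    rw [rpow_neg_half_eq] at h
    -- `b₀(t_c) ≥ 0.49 ε`
    have hbtc : 49 / 100 * ε ≤ Y 1 0 (tc K ε Y T) := by
      have hb := hs.b_zero_ge htc (fun u hu => hs.smallC_of_mem_tc hu) ⟨htc.1, le_rfl⟩
      have hK8 : (K ^ 8)⁻¹ ≤ 1 / 10 ^ 6 := by
        have := hs.inv_pow_succ_le 7
        have h7 : (K ^ 7)⁻¹ ≤ 1 := by
          have := hs.inv_pow_anti (n := 0) (m := 7) (by norm_num); simpa using this
        linarith
      have hK80 : 0 ≤ (K ^ 8)⁻¹ := by positivity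
      have h2 := hs.tc_lt_two
      nlinarith [mul_nonneg hε.le hK80, mul_le_mul_of_nonneg_left hhalf hε.le]
    -- the loss over the phase
    have hεexp := hs.ε_exp
    have hρ : C₁ * (1 + ε₀) ^ (-(n₀ : ℝ) / 2) ≤ 1 / 200 * ε := by
      have h1 := hs.ρ_le
      have hε1 := hs.ε_le_one hε
      have he : Real.exp (-10 * K ^ 10) ≤ 1 := by
        rw [Real.exp_le_one_iff]; have := pow_nonneg hK.le 10; linarith
      have hε6 : ε ≤ 1 / 10 ^ 6 := by
        have := hs.ε_le_K100
        have h100 : (K ^ 100)⁻¹ ≤ 1 / 10 ^ 6 := by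
          have h := hs.inv_pow_succ_le 99
          have h99 : (K ^ 99)⁻¹ ≤ 1 := by
            have := hs.inv_pow_anti (n := 0) (m := 99) (by norm_num); simpa using this
          linarith
        linarith
      calc C₁ * (1 + ε₀) ^ (-(n₀ : ℝ) / 2) ≤ ε ^ 4 * Real.exp (-10 * K ^ 10) := h1
        _ ≤ ε ^ 4 * 1 := by gcongr
        _ = ε * (ε * ε ^ 2) := by ring
        _ ≤ ε * (1 / 10 ^ 6 * 1 ^ 2) := by gcongr
        _ ≤ 1 / 200 * ε := by linarith
    have hloss : (ε * 0 - ε⁻¹ * K ^ 10 * C ^ 2 - C₁ * (1 + ε₀) ^ (-(n₀ : ℝ) / 2)) *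
        (t - tc K ε Y T) ≥ -(1 / 100 * ε) := by
      have hpos : 0 ≤ ε⁻¹ * K ^ 10 * C ^ 2 + C₁ * (1 + ε₀) ^ (-(n₀ : ℝ) / 2) := by
        have := hs.C₁_nn; have := hs.q_pos; positivity
      have hdt : 0 ≤ t - tc K ε Y T := by linarith [ht.1]
      -- `ε⁻¹ K¹⁰ C² ≤ 10⁻⁸ ε³ K¹⁰ e^{18K¹⁰} ≤ ε / 200`
      have hC2 : ε⁻¹ * K ^ 10 * C ^ 2 ≤ 1 / 200 * ε := by
        have hCsq : C ^ 2 = 1 / 10 ^ 8 * ε ^ 4 * Real.exp (18 * K ^ 10) := by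
          simp only [hC]
          rw [show (18 : ℝ) * K ^ 10 = 9 * K ^ 10 + 9 * K ^ 10 by ring, Real.exp_add]; ring
        have e : ε⁻¹ * K ^ 10 * C ^ 2 = 1 / 10 ^ 8 * ε * (ε ^ 2 * (K ^ 10 * Real.exp (18 * K ^ 10))) := by
          rw [hCsq]; field_simp
        rw [e]
        -- `ε² K¹⁰ e^{18K¹⁰} ≤ 1`: `ε ≤ e^{-10⁶K¹⁰}` twice
        have hb : ε ^ 2 * (K ^ 10 * Real.exp (18 * K ^ 10)) ≤ 1 := by
          have h1 : K ^ 10 ≤ Real.exp (10 ^ 6 * K ^ 10) := hs.K_pow_le_exp (by norm_num)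
          have h2 : ε * Real.exp (10 ^ 6 * K ^ 10) ≤ 1 := hεexp
          have h3 : ε * Real.exp (18 * K ^ 10) ≤ 1 := by
            calc ε * Real.exp (18 * K ^ 10) ≤ ε * Real.exp (10 ^ 6 * K ^ 10) := by
                  gcongr; linarith [pow_nonneg hK.le 10]
              _ ≤ 1 := h2
          calc ε ^ 2 * (K ^ 10 * Real.exp (18 * K ^ 10))
              = (ε * K ^ 10) * (ε * Real.exp (18 * K ^ 10)) := by ring
            _ ≤ (ε * Real.exp (10 ^ 6 * K ^ 10)) * 1 := by
                apply mul_le_mul _ h3 (by positivity) (by positivity); gcongr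
            _ ≤ 1 := by linarith
        nlinarith
      have hdt' : t - tc K ε Y T ≤ 1 := htK.trans (hs.K_rpow_neg_half_le.trans (by norm_num))
      have : (ε⁻¹ * K ^ 10 * C ^ 2 + C₁ * (1 + ε₀) ^ (-(n₀ : ℝ) / 2)) * (t - tc K ε Y T) ≤
          (1 / 200 * ε + 1 / 200 * ε) * 1 := by
        apply mul_le_mul (add_le_add hC2 hρ) hdt' hdt (by positivity)
      nlinarith
    rw [mul_zero] at hloss h
    linarith
  · have h := hs.abs_b_zero_le htT
    rw [abs_le] at h
    have hK7 : (K ^ 7)⁻¹ ≤ 1 / 10 ^ 5 := hs.inv_K7_le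
    have : (1 / 10 ^ 5 + t + (K ^ 7)⁻¹) * ε ≤ 4 * ε := by
      apply mul_le_mul_of_nonneg_right _ hε.le; linarith
    linarith [h.2]

/-- `ρ = C₁(1+ε₀)^{-n₀/2} ≤ ε⁴` and `ε² ≤ 10⁻⁶ K⁻¹⁰`: the two smallness facts used on the rotor
phase. [folklore] -/
theorem Setting.ρ_le_ε4 (hs : Setting ε₀ K ε C₁ C₂ C₃ C₄ C₅ n₀ N τ Y F T) :
    C₁ * (1 + ε₀) ^ (-(n₀ : ℝ) / 2) ≤ ε ^ 4 ∧ ε ^ 2 ≤ 1 / 10 ^ 6 * (K ^ 10)⁻¹ := by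
  have hK := hs.K_pos
  have hε := hs.ε_pos
  have hε1 := hs.ε_le_one hε
  constructor
  · have h1 := hs.ρ_le
    have he : Real.exp (-10 * K ^ 10) ≤ 1 := by
      rw [Real.exp_le_one_iff]; have := pow_nonneg hK.le 10; linarith
    calc C₁ * (1 + ε₀) ^ (-(n₀ : ℝ) / 2) ≤ ε ^ 4 * Real.exp (-10 * K ^ 10) := h1
      _ ≤ ε ^ 4 * 1 := by gcongr
      _ = ε ^ 4 := mul_one _
  · have hεK := hs.ε_le_K100
    have h100 : (K ^ 100)⁻¹ ≤ 1 / 10 ^ 6 * (K ^ 10)⁻¹ :=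
      (hs.inv_pow_anti (by norm_num : 11 ≤ 100)).trans (hs.inv_pow_succ_le 10)
    calc ε ^ 2 = ε * ε := sq ε
      _ ≤ 1 * (K ^ 100)⁻¹ := by gcongr
      _ ≤ 1 / 10 ^ 6 * (K ^ 10)⁻¹ := by rw [one_mul]; exact h100

/-- **(6.163)–(6.164): exponential growth of `c₀` from `c₀(t_c) = K⁻¹⁰ε²`** on the rotor phase:
`c₀(t) ≥ ½ K⁻¹⁰ ε² exp(0.48 K¹⁰ (t - t_c))` (by the landed `zero_c_lower_on` with `b₀ ≥ 0.48ε`).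
[cite: Tao2016AveragedNS, §6.7 (6.163)–(6.164)] -/
theorem Setting.c_zero_rotor_lower (hs : Setting ε₀ K ε C₁ C₂ C₃ C₄ C₅ n₀ N τ Y F T)
    (hex : ExitTrichotomy ε₀ K Y F T) {t : ℝ} (ht : t ∈ Icc (tc K ε Y T) (τone K ε Y T)) :
    Real.exp (48 / 100 * K ^ 10 * (t - tc K ε Y T)) * (1 / 2 * ((K ^ 10)⁻¹ * ε ^ 2)) ≤ Y 2 0 t := by
  have hK := hs.K_pos
  have hε := hs.ε_pos
  have htc := hs.tc_mem
  have hctc := hs.c_zero_tc hex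
  obtain ⟨hρ4, hε2⟩ := hs.ρ_le_ε4
  have hreg : ∀ u ∈ Icc (tc K ε Y T) (τone K ε Y T), F 0 u ≤ 1 := fun u hu =>
    hs.F_zero_le_one (hs.mem_rotor hex hu).1
  have hb : ∀ u ∈ Icc (tc K ε Y T) (τone K ε Y T), 48 / 100 * ε ≤ Y 1 0 u := fun u hu =>
    (hs.b_zero_rotor hex hu).1
  have hdt : 0 ≤ t - tc K ε Y T := by linarith [ht.1]
  have hdt1 : t - tc K ε Y T ≤ 1 :=
    (hs.mem_rotor hex ht).2.2.trans (hs.K_rpow_neg_half_le.trans (by norm_num))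
  have hK10 : 0 < (K ^ 10)⁻¹ := by positivity
  -- `ρ (t - t_c) ≤ ρ ≤ ε⁴ ≤ ½ K⁻¹⁰ ε²`
  have hρsmall : C₁ * (1 + ε₀) ^ (-(n₀ : ℝ) / 2) * (t - tc K ε Y T) ≤ 1 / 2 * ((K ^ 10)⁻¹ * ε ^ 2) := by
    have hρ0 : 0 ≤ C₁ * (1 + ε₀) ^ (-(n₀ : ℝ) / 2) :=
      mul_nonneg hs.C₁_nn (Real.rpow_nonneg hs.q_pos.le _)
    calc C₁ * (1 + ε₀) ^ (-(n₀ : ℝ) / 2) * (t - tc K ε Y T)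
        ≤ ε ^ 4 * 1 := mul_le_mul hρ4 hdt1 hdt (by positivity)
      _ = ε ^ 2 * ε ^ 2 := by ring
      _ ≤ (1 / 10 ^ 6 * (K ^ 10)⁻¹) * ε ^ 2 := by gcongr
      _ ≤ 1 / 2 * ((K ^ 10)⁻¹ * ε ^ 2) := by nlinarith [sq_nonneg ε]
  have hc0 : C₁ * (1 + ε₀) ^ (-((n₀ : ℝ) / 2)) * (t - tc K ε Y T) ≤ Y 2 0 (tc K ε Y T) := by
    rw [rpow_neg_half_eq, hctc]; linarith [mul_pos hK10 (pow_pos hε 2)]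
  have h := hs.hyp.zero_c_lower_on hε.le hs.C₁_nn hs.ε₀_pos (hs.τ₀_le.trans htc.1)
    (by positivity : (0:ℝ) ≤ 48 / 100 * ε) hreg hb ht hc0
  rw [rpow_neg_half_eq, hctc] at h
  have he : ε⁻¹ * K ^ 10 * (48 / 100 * ε) * (t - tc K ε Y T) = 48 / 100 * K ^ 10 * (t - tc K ε Y T) := by
    field_simp
  rw [he] at h
  refine le_trans ?_ h
  apply mul_le_mul_of_nonneg_left _ (Real.exp_pos _).le
  linarith

/-- `2 K¹¹⁰ ≤ exp(0.48 K)` for `K ≥ 10⁶` (via `(1 + x/n)ⁿ ≤ eˣ` with `n = 220`). [folklore] -/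
theorem two_mul_pow_le_exp {K : ℝ} (hK : (10 : ℝ) ^ 6 ≤ K) :
    2 * K ^ 110 ≤ Real.exp (48 / 100 * K) := by
  have hK0 : 0 ≤ K := le_trans (by norm_num) hK
  set x : ℝ := 48 / 100 * K / 220 with hx
  have hx0 : 0 ≤ x := by positivity
  have h1 : (1 + x) ^ 220 ≤ Real.exp (48 / 100 * K) := by
    have := Real.add_one_le_exp x
    calc (1 + x) ^ 220 ≤ (Real.exp x) ^ 220 := pow_le_pow_left₀ (by positivity) (by linarith) 220
      _ = Real.exp (220 * x) := by rw [← Real.exp_nat_mul]; norm_num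
      _ = Real.exp (48 / 100 * K) := by congr 1; simp only [hx]; ring
  have h2 : x ^ 220 ≤ (1 + x) ^ 220 := pow_le_pow_left₀ hx0 (by linarith) 220
  -- `x² ≥ 4K`, so `x²²⁰ = (x²)¹¹⁰ ≥ (4K)¹¹⁰ ≥ 2 K¹¹⁰`
  have hx2 : 4 * K ≤ x ^ 2 := by
    simp only [hx]; nlinarith
  have h3 : (4 * K) ^ 110 ≤ x ^ 220 := by
    rw [show x ^ 220 = (x ^ 2) ^ 110 by ring]
    exact pow_le_pow_left₀ (by positivity) hx2 110
  have h4 : 2 * K ^ 110 ≤ (4 * K) ^ 110 := by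
    rw [mul_pow]
    apply mul_le_mul_of_nonneg_right _ (by positivity)
    norm_num
  linarith

/-- **(6.165): `c₀ ≥ K¹⁰⁰ ε²` on `I = [t_c + K⁻⁹, τ₁]`.** [cite: Tao2016AveragedNS, §6.7 (6.165)] -/
theorem Setting.c_zero_large (hs : Setting ε₀ K ε C₁ C₂ C₃ C₄ C₅ n₀ N τ Y F T)
    (hex : ExitTrichotomy ε₀ K Y F T) {t : ℝ}
    (ht : t ∈ Icc (tc K ε Y T + (K ^ 9)⁻¹) (τone K ε Y T)) : K ^ 100 * ε ^ 2 ≤ Y 2 0 t := by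
  have hK := hs.K_pos
  have hε := hs.ε_pos
  have hK9 : 0 < (K ^ 9)⁻¹ := by positivity
  have ht' : t ∈ Icc (tc K ε Y T) (τone K ε Y T) := ⟨by linarith [ht.1], ht.2⟩
  have h := hs.c_zero_rotor_lower hex ht'
  refine le_trans ?_ h
  have hgrow : Real.exp (48 / 100 * K) ≤ Real.exp (48 / 100 * K ^ 10 * (t - tc K ε Y T)) := by
    apply Real.exp_le_exp.2
    have hdt : (K ^ 9)⁻¹ ≤ t - tc K ε Y T := by linarith [ht.1]
    have e : 48 / 100 * K = 48 / 100 * K ^ 10 * (K ^ 9)⁻¹ := by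
      field_simp
    calc 48 / 100 * K = 48 / 100 * K ^ 10 * (K ^ 9)⁻¹ := e
      _ ≤ 48 / 100 * K ^ 10 * (t - tc K ε Y T) := by gcongr
  have h2 := two_mul_pow_le_exp hs.K_large
  have hK10 : (K ^ 10)⁻¹ * K ^ 110 = K ^ 100 := by field_simp
  calc K ^ 100 * ε ^ 2 = (2 * K ^ 110) * (1 / 2 * ((K ^ 10)⁻¹ * ε ^ 2)) := by
        rw [← hK10]; ring
    _ ≤ Real.exp (48 / 100 * K) * (1 / 2 * ((K ^ 10)⁻¹ * ε ^ 2)) := by gcongr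
    _ ≤ Real.exp (48 / 100 * K ^ 10 * (t - tc K ε Y T)) * (1 / 2 * ((K ^ 10)⁻¹ * ε ^ 2)) := by
        gcongr

/-- `c₀ > 0` and `c₀ ≥ ½ K⁻¹⁰ ε²` on the rotor phase. [cite: Tao2016AveragedNS, §6.7 (6.163)] -/
theorem Setting.c_zero_rotor_pos (hs : Setting ε₀ K ε C₁ C₂ C₃ C₄ C₅ n₀ N τ Y F T)
    (hex : ExitTrichotomy ε₀ K Y F T) {t : ℝ} (ht : t ∈ Icc (tc K ε Y T) (τone K ε Y T)) :
    1 / 2 * ((K ^ 10)⁻¹ * ε ^ 2) ≤ Y 2 0 t ∧ 0 < Y 2 0 t := by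
  have h := hs.c_zero_rotor_lower hex ht
  have hK := hs.K_pos
  have hε := hs.ε_pos
  have hbase : 0 < 1 / 2 * ((K ^ 10)⁻¹ * ε ^ 2) := by positivity
  have hexp : 1 ≤ Real.exp (48 / 100 * K ^ 10 * (t - tc K ε Y T)) := by
    apply Real.one_le_exp; have := pow_nonneg hK.le 10; have := ht.1; nlinarith
  have h1 : 1 / 2 * ((K ^ 10)⁻¹ * ε ^ 2) ≤ Y 2 0 t := le_trans (by nlinarith) h
  exact ⟨h1, hbase.trans_le h1⟩

/-- **(6.166)–(6.167): the matching upper bound**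
`c₀(t) ≤ 2 K⁻¹⁰ ε² exp(4 K¹⁰ (t - t_c)) ≤ 2 K⁻¹⁰ ε² exp(4 K¹⁰ K^{-1/2})` on the rotor phase (by the
landed `zero_c_upper_on` with `b₀ ≤ 4ε`, `a₀² ≤ 2`). [cite: Tao2016AveragedNS, §6.7 (6.166)–(6.167)] -/
theorem Setting.c_zero_rotor_upper (hs : Setting ε₀ K ε C₁ C₂ C₃ C₄ C₅ n₀ N τ Y F T)
    (hex : ExitTrichotomy ε₀ K Y F T) {t : ℝ} (ht : t ∈ Icc (tc K ε Y T) (τone K ε Y T)) :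
    Y 2 0 t ≤ Real.exp (4 * K ^ 10 * (t - tc K ε Y T)) * (2 * ((K ^ 10)⁻¹ * ε ^ 2)) ∧
      Y 2 0 t ≤ Real.exp (4 * K ^ 10 * K ^ (-(1 : ℝ) / 2)) * (2 * ((K ^ 10)⁻¹ * ε ^ 2)) := by
  have hK := hs.K_pos
  have hε := hs.ε_pos
  have htc := hs.tc_mem
  have hctc := hs.c_zero_tc hex
  obtain ⟨hρ4, hε2⟩ := hs.ρ_le_ε4
  have hreg : ∀ u ∈ Icc (tc K ε Y T) (τone K ε Y T), F 0 u ≤ 1 := fun u hu =>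
    hs.F_zero_le_one (hs.mem_rotor hex hu).1
  have hA : ∀ u ∈ Icc (tc K ε Y T) (τone K ε Y T), Y 0 0 u ^ 2 ≤ Real.sqrt 2 ^ 2 := fun u hu => by
    rw [Real.sq_sqrt (by norm_num)]; exact hs.sq_Y_zero_le 0 (hs.mem_rotor hex hu).1
  have hb : ∀ u ∈ Icc (tc K ε Y T) (τone K ε Y T), Y 1 0 u ≤ 4 * ε := fun u hu =>
    (hs.b_zero_rotor hex hu).2
  have hc : ∀ u ∈ Icc (tc K ε Y T) (τone K ε Y T), 0 ≤ Y 2 0 u := fun u hu =>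
    (hs.c_zero_rotor_pos hex hu).2.le
  have h := hs.hyp.zero_c_upper_on hε.le hs.C₁_nn hs.ε₀_pos (hs.τ₀_le.trans htc.1)
    (by positivity : (0:ℝ) ≤ 4 * ε) hreg hA hb hc ht
  rw [rpow_neg_half_eq, hctc, Real.sq_sqrt (by norm_num)] at h
  have he : ε⁻¹ * K ^ 10 * (4 * ε) * (t - tc K ε Y T) = 4 * K ^ 10 * (t - tc K ε Y T) := by
    field_simp
  rw [he] at h
  have hdt : 0 ≤ t - tc K ε Y T := by linarith [ht.1]
  have hdt' := (hs.mem_rotor hex ht).2.2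
  have hdt1 : t - tc K ε Y T ≤ 1 := hdt'.trans (hs.K_rpow_neg_half_le.trans (by norm_num))
  have hK10 : 0 < (K ^ 10)⁻¹ := by positivity
  -- the source term over the phase is `≤ K⁻¹⁰ ε²`
  have hsrc : (ε ^ 2 * Real.exp (-K ^ 10) * 2 + C₁ * (1 + ε₀) ^ (-(n₀ : ℝ) / 2)) *
      (t - tc K ε Y T) ≤ (K ^ 10)⁻¹ * ε ^ 2 := by
    have hexp : Real.exp (-K ^ 10) ≤ (K ^ 10)⁻¹ * (1 / 4) := by
      have h1 : Real.exp (-K ^ 10) ≤ Real.exp (-K ^ 10 / 2) := by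
        apply Real.exp_le_exp.2; have := pow_nonneg hK.le 10; linarith
      have h2 := hs.exp_half_le
      have h3 : (K ^ 100)⁻¹ ≤ 1 / 10 ^ 6 * (K ^ 10)⁻¹ :=
        (hs.inv_pow_anti (by norm_num : 11 ≤ 100)).trans (hs.inv_pow_succ_le 10)
      nlinarith
    have hρ' : C₁ * (1 + ε₀) ^ (-(n₀ : ℝ) / 2) ≤ (K ^ 10)⁻¹ * ε ^ 2 * (1 / 2) := by
      calc C₁ * (1 + ε₀) ^ (-(n₀ : ℝ) / 2) ≤ ε ^ 4 := hρ4
        _ = ε ^ 2 * ε ^ 2 := by ring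
        _ ≤ (1 / 10 ^ 6 * (K ^ 10)⁻¹) * ε ^ 2 := by gcongr
        _ ≤ (K ^ 10)⁻¹ * ε ^ 2 * (1 / 2) := by nlinarith [sq_nonneg ε]
    have hpos : 0 ≤ ε ^ 2 * Real.exp (-K ^ 10) * 2 + C₁ * (1 + ε₀) ^ (-(n₀ : ℝ) / 2) := by
      have := hs.C₁_nn; have := hs.q_pos; positivity
    calc (ε ^ 2 * Real.exp (-K ^ 10) * 2 + C₁ * (1 + ε₀) ^ (-(n₀ : ℝ) / 2)) * (t - tc K ε Y T)
        ≤ (ε ^ 2 * Real.exp (-K ^ 10) * 2 + C₁ * (1 + ε₀) ^ (-(n₀ : ℝ) / 2)) * 1 := by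
          gcongr
      _ ≤ (K ^ 10)⁻¹ * ε ^ 2 := by nlinarith [sq_nonneg ε]
  have h1 : Y 2 0 t ≤ Real.exp (4 * K ^ 10 * (t - tc K ε Y T)) * (2 * ((K ^ 10)⁻¹ * ε ^ 2)) := by
    refine h.trans ?_
    apply mul_le_mul_of_nonneg_left _ (Real.exp_pos _).le
    have : ε ^ 2 * Real.exp (-K ^ 10) * 2 = ε ^ 2 * Real.exp (-K ^ 10) * Real.sqrt 2 ^ 2 := by
      rw [Real.sq_sqrt (by norm_num)]
    linarith
  refine ⟨h1, h1.trans ?_⟩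
  have := pow_nonneg hK.le 10
  gcongr

/-- **(6.164), (6.166), (6.181): `0.4 K¹⁰ c₀ ≤ ∂ₜc₀ ≤ 5 K¹⁰ c₀`** on the rotor phase; in
particular `|∂ₜc₀| ≤ 5 K¹⁰ c₀`. [cite: Tao2016AveragedNS, §6.7 (6.164), (6.166), (6.181)] -/
theorem Setting.dc_zero_rotor (hs : Setting ε₀ K ε C₁ C₂ C₃ C₄ C₅ n₀ N τ Y F T)
    (hex : ExitTrichotomy ε₀ K Y F T) {t : ℝ} (ht : t ∈ Icc (tc K ε Y T) (τone K ε Y T)) :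
    4 / 10 * K ^ 10 * Y 2 0 t ≤ dY (τ (n₀ - N)) Y 2 0 t ∧
      dY (τ (n₀ - N)) Y 2 0 t ≤ 5 * K ^ 10 * Y 2 0 t ∧
      |dY (τ (n₀ - N)) Y 2 0 t| ≤ 5 * K ^ 10 * Y 2 0 t := by
  have hK := hs.K_pos
  have hε := hs.ε_pos
  have htT := (hs.mem_rotor hex ht).1
  obtain ⟨hρ4, hε2⟩ := hs.ρ_le_ε4
  have h := hs.hyp.zero_c_deriv_bounds hs.C₁_nn hs.ε₀_pos (hs.τ₀_le.trans htT.1)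
    (hs.F_zero_le_one htT) (A := Real.sqrt 2)
    (by rw [Real.sq_sqrt (by norm_num)]; exact hs.sq_Y_zero_le 0 htT)
  rw [rpow_neg_half_eq, Real.sq_sqrt (by norm_num)] at h
  obtain ⟨hlo, hhi⟩ := h
  obtain ⟨hb1, hb2⟩ := hs.b_zero_rotor hex ht
  obtain ⟨hc1, hcpos⟩ := hs.c_zero_rotor_pos hex ht
  set c := Y 2 0 t
  set D := dY (τ (n₀ - N)) Y 2 0 t
  have hD : D = derivWithin (Y 2 0) (Ici (τ (n₀ - N))) t := rfl
  rw [← hD] at hlo hhi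
  have hK10 : 0 < (K ^ 10)⁻¹ := by positivity
  -- the bilinear term: `0.48 K¹⁰ c ≤ ε⁻¹K¹⁰ b₀ c ≤ 4 K¹⁰ c`
  have hbc_lo : 48 / 100 * K ^ 10 * c ≤ ε⁻¹ * K ^ 10 * Y 1 0 t * c := by
    have : ε⁻¹ * K ^ 10 * Y 1 0 t * c = K ^ 10 * c * (ε⁻¹ * Y 1 0 t) := by ring
    rw [this]
    have h2 : 48 / 100 ≤ ε⁻¹ * Y 1 0 t := by
      rw [le_inv_mul_iff₀ hε]; linarith
    nlinarith [mul_pos (pow_pos hK 10) hcpos]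
  have hbc_hi : ε⁻¹ * K ^ 10 * Y 1 0 t * c ≤ 4 * K ^ 10 * c := by
    have : ε⁻¹ * K ^ 10 * Y 1 0 t * c = K ^ 10 * c * (ε⁻¹ * Y 1 0 t) := by ring
    rw [this]
    have h2 : ε⁻¹ * Y 1 0 t ≤ 4 := by
      rw [inv_mul_le_iff₀ hε]; linarith
    nlinarith [mul_pos (pow_pos hK 10) hcpos]
  -- the small terms are `≤ (8/100) K¹⁰ c`
  have hsmall : ε ^ 2 * Real.exp (-K ^ 10) * 2 + C₁ * (1 + ε₀) ^ (-(n₀ : ℝ) / 2) ≤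
      8 / 100 * K ^ 10 * c := by
    have hKc : 1 / 2 * ε ^ 2 ≤ K ^ 10 * c := by
      have : K ^ 10 * (1 / 2 * ((K ^ 10)⁻¹ * ε ^ 2)) = 1 / 2 * ε ^ 2 := by field_simp
      rw [← this]; exact mul_le_mul_of_nonneg_left hc1 (pow_nonneg hK.le 10)
    have hexp : Real.exp (-K ^ 10) ≤ 1 / 100 := by
      have := hs.exp_half_le
      have h1 : Real.exp (-K ^ 10) ≤ Real.exp (-K ^ 10 / 2) := by
        apply Real.exp_le_exp.2; have := pow_nonneg hK.le 10; linarith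
      have h3 : (K ^ 100)⁻¹ ≤ 1 / 100 := by
        have := hs.inv_pow_succ_le 99
        have h99 : (K ^ 99)⁻¹ ≤ 1 := by
          have := hs.inv_pow_anti (n := 0) (m := 99) (by norm_num); simpa using this
        linarith
      linarith
    have hρ' : C₁ * (1 + ε₀) ^ (-(n₀ : ℝ) / 2) ≤ ε ^ 2 * (1 / 100) := by
      have hε1 := hs.ε_le_one hε
      calc C₁ * (1 + ε₀) ^ (-(n₀ : ℝ) / 2) ≤ ε ^ 4 := hρ4
        _ = ε ^ 2 * ε ^ 2 := by ring
        _ ≤ ε ^ 2 * (1 / 100) := by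
            gcongr
            have h10 : (K ^ 10)⁻¹ ≤ 1 := by
              have := hs.inv_pow_anti (n := 0) (m := 10) (by norm_num); simpa using this
            linarith
    nlinarith [sq_nonneg ε]
  have hpos2 : 0 ≤ ε ^ 2 * Real.exp (-K ^ 10) * 2 := by positivity
  have hρ0 : 0 ≤ C₁ * (1 + ε₀) ^ (-(n₀ : ℝ) / 2) :=
    mul_nonneg hs.C₁_nn (Real.rpow_nonneg hs.q_pos.le _)
  have hKc := mul_pos (pow_pos hK 10) hcpos
  refine ⟨by linarith, by linarith, ?_⟩
  rw [abs_le]; constructor <;> linarith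

/-- **`∫₀ᵗ a₁² < K^{-1/4}` for `t ≤ τ₁`** (the display after (6.160): `∫₀^{t_c} a₁² ≲ K⁻¹⁰` and
`τ₁ - t_c ≤ K^{-1/2}`, with `a₁² ≤ 2`). [cite: Tao2016AveragedNS, §6.7 (after (6.160))] -/
theorem Setting.integral_a_one_sq_lt (hs : Setting ε₀ K ε C₁ C₂ C₃ C₄ C₅ n₀ N τ Y F T)
    (hex : ExitTrichotomy ε₀ K Y F T) {t : ℝ} (ht : t ∈ Icc 0 (τone K ε Y T)) :
    ∫ s in (0:ℝ)..t, Y 0 1 s ^ 2 < K ^ (-(1 : ℝ) / 4) := by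
  have hK := hs.K_pos
  have hε := hs.ε_pos
  have htc := hs.tc_mem
  obtain ⟨hτ1, hτ2, hτ3, hτ4⟩ := hs.τone_bounds hex
  have htc2 := hs.tc_lt_two
  have hτ₀ := hs.τ₀_le
  have hP : ∀ s ∈ Icc 0 (tc K ε Y T), SmallC K ε Y s := fun u hu => hs.smallC_of_mem_tc hu
  -- numerics: `K^{-1/2} ≤ ¼ K^{-1/4}` and `10⁶ K⁻²⁰ ≤ ¼ K^{-1/4}`
  have hq0 : 0 < K ^ (-(1 : ℝ) / 4) := Real.rpow_pos_of_pos hK _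
  have hq_half : K ^ (-(1 : ℝ) / 2) = K ^ (-(1 : ℝ) / 4) * K ^ (-(1 : ℝ) / 4) := by
    rw [← Real.rpow_add hK]; norm_num
  have hq_small : K ^ (-(1 : ℝ) / 4) ≤ 1 / 4 := by
    -- `K^{1/4} ≥ 4` as `K ≥ 256`
    have h256 : (4 : ℝ) = (256 : ℝ) ^ ((1 : ℝ) / 4) := by
      rw [show (256 : ℝ) = 4 ^ (4 : ℕ) by norm_num, show (1:ℝ)/4 = ((4:ℕ):ℝ)⁻¹ by norm_num]
      exact (Real.pow_rpow_inv_natCast (by norm_num) (by norm_num)).symm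
    have h4 : (4 : ℝ) ≤ K ^ ((1 : ℝ) / 4) := by
      calc (4 : ℝ) = (256 : ℝ) ^ ((1 : ℝ) / 4) := h256
        _ ≤ K ^ ((1 : ℝ) / 4) :=
          Real.rpow_le_rpow (by norm_num) (by linarith [hs.K_large]) (by norm_num)
    rw [show -(1 : ℝ) / 4 = -((1 : ℝ) / 4) by ring, Real.rpow_neg hK.le,
      show (1 : ℝ) / 4 = (4 : ℝ)⁻¹ by norm_num]
    exact inv_anti₀ (by norm_num) (by simpa using h4)
  have hK_half_le : K ^ (-(1 : ℝ) / 2) ≤ 1 / 4 * K ^ (-(1 : ℝ) / 4) := by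
    rw [hq_half]; exact mul_le_mul_of_nonneg_right hq_small hq0.le
  have hK20 : 2 * (700 * (K ^ 10)⁻¹) ^ 2 ≤ 1 / 4 * K ^ (-(1 : ℝ) / 4) := by
    have h10 : (K ^ 10)⁻¹ ≤ 1 / 10 ^ 6 * (K ^ 9)⁻¹ := hs.inv_pow_succ_le 9
    have h9 : (K ^ 9)⁻¹ ≤ 1 / 10 ^ 6 * (K ^ 8)⁻¹ := hs.inv_pow_succ_le 8
    have h8 : (K ^ 8)⁻¹ ≤ (K ^ 1)⁻¹ := hs.inv_pow_anti (by norm_num)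
    have hq : (K ^ 1)⁻¹ ≤ K ^ (-(1 : ℝ) / 4) := by
      rw [pow_one, ← Real.rpow_neg_one]
      exact Real.rpow_le_rpow_of_exponent_le hs.one_le_K (by norm_num)
    have h10' : (K ^ 10)⁻¹ ≤ 1 := by
      have := hs.inv_pow_anti (n := 0) (m := 10) (by norm_num); simpa using this
    have hK10 : 0 ≤ (K ^ 10)⁻¹ := by positivity
    calc 2 * (700 * (K ^ 10)⁻¹) ^ 2 = 980000 * ((K ^ 10)⁻¹ * (K ^ 10)⁻¹) := by ring
      _ ≤ 980000 * ((K ^ 10)⁻¹ * 1) := by gcongr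
      _ ≤ 980000 * (1 / 10 ^ 6 * (1 / 10 ^ 6 * K ^ (-(1 : ℝ) / 4))) := by
          rw [mul_one]; gcongr
          calc (K ^ 10)⁻¹ ≤ 1 / 10 ^ 6 * (K ^ 9)⁻¹ := h10
            _ ≤ 1 / 10 ^ 6 * (1 / 10 ^ 6 * (K ^ 8)⁻¹) := by gcongr
            _ ≤ _ := by gcongr; exact h8.trans hq
      _ ≤ 1 / 4 * K ^ (-(1 : ℝ) / 4) := by nlinarith
  rcases le_or_gt t (tc K ε Y T) with hle | hgt
  · have h := hs.integral_a_one_sq_le htc hP ⟨ht.1, hle⟩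
    have hK10 : 0 ≤ (K ^ 10)⁻¹ := by positivity
    have : (700 * (K ^ 10)⁻¹) ^ 2 * t ≤ (700 * (K ^ 10)⁻¹) ^ 2 * 2 :=
      mul_le_mul_of_nonneg_left (by linarith) (by positivity)
    linarith
  · -- split at `t_c`
    have hcont : ContinuousOn (fun s => Y 0 1 s ^ 2) (Icc 0 t) := (hs.continuousOn_Y 0 1 hτ₀).pow 2
    have hi1 : IntervalIntegrable (fun s => Y 0 1 s ^ 2) volume 0 (tc K ε Y T) :=
      (hcont.mono (Icc_subset_Icc le_rfl hgt.le)).intervalIntegrable_of_Icc htc.1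
    have hi2 : IntervalIntegrable (fun s => Y 0 1 s ^ 2) volume (tc K ε Y T) t :=
      (hcont.mono (Icc_subset_Icc htc.1 le_rfl)).intervalIntegrable_of_Icc hgt.le
    rw [← intervalIntegral.integral_add_adjacent_intervals hi1 hi2]
    have h1 := hs.integral_a_one_sq_le htc hP ⟨htc.1, le_rfl⟩
    have h2 : ∫ s in (tc K ε Y T)..t, Y 0 1 s ^ 2 ≤ 2 * (t - tc K ε Y T) := by
      have hle : ∀ s ∈ Icc (tc K ε Y T) t, Y 0 1 s ^ 2 ≤ 2 := fun u hu =>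
        hs.sq_Y_one_le 0 ⟨htc.1.trans hu.1, hu.2.trans (ht.2.trans hτ2)⟩
      calc ∫ s in (tc K ε Y T)..t, Y 0 1 s ^ 2 ≤ ∫ s in (tc K ε Y T)..t, (2:ℝ) :=
            intervalIntegral.integral_mono_on hgt.le hi2 intervalIntegrable_const hle
        _ = 2 * (t - tc K ε Y T) := by simp [mul_comm]
    have hdt : t - tc K ε Y T ≤ K ^ (-(1 : ℝ) / 2) := by linarith [ht.2]
    have hK10 : 0 ≤ (K ^ 10)⁻¹ := by positivity
    have : (700 * (K ^ 10)⁻¹) ^ 2 * tc K ε Y T ≤ (700 * (K ^ 10)⁻¹) ^ 2 * 2 :=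
      mul_le_mul_of_nonneg_left htc2.le (by positivity)
    nlinarith

/-- **Prop. 6.16 (exit dichotomy)**: either `Ẽ₋₁(τ₁) = K⁻¹⁰(1+ε₀)^{2/10}` (backwards flow of
energy) or `τ₁ = t_c + K^{-1/2}` (running out the clock). [cite: Tao2016AveragedNS, §6.7 Prop. 6.16] -/
theorem Setting.exit_dichotomy (hs : Setting ε₀ K ε C₁ C₂ C₃ C₄ C₅ n₀ N τ Y F T)
    (hex : ExitTrichotomy ε₀ K Y F T) :
    F (-1) (τone K ε Y T) = (K ^ 10)⁻¹ * (1 + ε₀) ^ ((2 : ℝ) / 10) ∨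
      τone K ε Y T = tc K ε Y T + K ^ (-(1 : ℝ) / 2) := by
  obtain ⟨hτ1, hτ2, hτ3, hτ4⟩ := hs.τone_bounds hex
  by_cases h : τone K ε Y T = tc K ε Y T + K ^ (-(1 : ℝ) / 2)
  · exact Or.inr h
  · left
    -- then `τ₁ = T`
    have hT : τone K ε Y T = T := by
      unfold τone at h ⊢
      rcases le_total (tc K ε Y T + K ^ (-(1 : ℝ) / 2)) T with h1 | h1
      · exact absurd (min_eq_left h1) h
      · exact min_eq_right h1
    have hint := hs.integral_a_one_sq_lt hex (t := T) ⟨hs.T_nn, hT.symm.le⟩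
    rw [hT]
    rcases hex with h1 | h2 | h3
    · exact h1
    · exfalso
      rw [h2] at hint; exact lt_irrefl _ hint
    · exfalso; linarith

end Transition

end ZeroScale

end TaoCascade

end Literature.Analysis.FluidPDE
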